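import Summits.CriticalPhenomena.PercolationContinuityZ3.Theorems.PercNearOneGluingNoHeavyQuantLawDecUsageMonge
import HarnessLib

/-!
# QUANT lane R8, T-DEC: the MONGE PROPERTY of the DEC usage rates, part 2 — `LawDec.usage` is antitone in the low atom, antitone in
# the mid, and log-supermodular on compatible quadruples (giant/mid case split over part 1's closed-form inequalities)

builds on p205010 (kernel theorem, internal audit signed; external expert review pending)

Support file (`--supports stmt-CriticalPhenomena-4575`), QUANT lane lead seat (gen 21), rung R8 of
`run/shared/lean/prim/quant/LADDER.md`; memo `run/shared/lean/prim/quant/prim-quant-lead-g21/LEAD-NOTES-G21.md` N45.  Theorems only,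
standard axioms, no sorries.  Part 1 is `…QuantLawDecUsageMonge` (`usage_mid_eq`, `usage_giant_eq`, `phi_mono`, `heavy_monge`,
`light_monge`, `heavy_light_monge`, `light_heavy_monge`).

* **`LawDec.usage_anti_low`** — lows `l₁ < l₂` (`2l₂ < T`), an absorber `h` compatible with `l₁` (`T < l₁ + h`), giant or mid (`2h ≥ T`)
  ⟹ `usage(l₂,h) ≤ usage(l₁,h)`: higher lows are cheaper to ship.
* **`LawDec.usage_anti_mid`** — a low `l`, mids `h₁ < h₂ ≤ j′` with `T < l + h₁` ⟹ `usage(l,h₂) ≤ usage(l,h₁)`: higher mids are cheaper absorbers.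
* **`LawDec.usage_monge`** — lows `l₁ < l₂` (`2l₂ < T`), absorbers `h₁ < h₂` with `T < l₁ + h₁`, `h₁` a giant or a mid ⟹
  `usage(l₂,h₁)·usage(l₁,h₂) ≤ usage(l₁,h₁)·usage(l₂,h₂)` (two giants: equality; mid + giant: antitonicity in `l`; two mids: the four
  closed-form inequalities of part 1 and `max·max ≤ max·max`).
USE (memo N45): the exchange "uncross `l₁ → h₂`, `l₂ → h₁` into `l₁ → h₁`, `l₂ → h₂`" never ships less low mass nor loads an absorber more,
so every `LawDec.FlowAtT` datum can be CORNERED (south-west corner rule: lows in decreasing order into mids in increasing order, leftovers to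
the giants) — the canonical optimal flow of DEC(j′) found by the lead's exact census (kit j135057), and the normal form proposed for a proof
of `LawDec.SliceClosed` / `LawDec.SDECConvClosed`.

[this work]; Monge arrays / corner rules: Hoffman 1963, Burkard–Klinz–Rudolf 1996 (classical; nothing specific to these rates in print).
The gluing rows served [cite: KozmaNitzan2024, Conjecture 3 (p. 15)]; product measure [cite: Grimmett1999, §1.3 p. 10].
-/

noncomputable section

namespace Summit.CriticalPhenomena.PercolationContinuityZ3.Theorems

namespace Quant

namespace LawDec

/-! ### The usage rate: antitone in the low atom, antitone in the mid, and the Monge inequality -/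

/-- **usage is antitone in the low atom**: for lows `l₁ < l₂` (`2l₂ < T`) and an absorber `h` compatible with `l₁` (`T < l₁ + h`) that
is a giant (`h ≥ j′+1`) or a mid (`2h ≥ T`), `usage(l₂,h) ≤ usage(l₁,h)` (`0 < x < 1`). [this work] -/
theorem usage_anti_low (x T : ℝ) (j' l₁ l₂ h : ℕ) (hx0 : 0 < x) (hx1 : x < 1) (hl : l₁ < l₂) (hlow : 2 * (l₂ : ℝ) < T)
    (hcomp : T < (l₁ : ℝ) + h) (habs : j' + 1 ≤ h ∨ T ≤ 2 * (h : ℝ)) :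
    usage x T j' l₂ h ≤ usage x T j' l₁ h := by
  by_cases hg : j' + 1 ≤ h
  · rw [usage_giant_eq x T j' l₂ h hg, usage_giant_eq x T j' l₁ h hg]
  · have hmid : T ≤ 2 * (h : ℝ) := habs.resolve_left hg
    have hhj : h ≤ j' := by omega
    have hl' : (l₁ : ℝ) < l₂ := by exact_mod_cast hl
    have hlow1 : 2 * (l₁ : ℝ) < T := by linarith
    have hcomp2 : T < (l₂ : ℝ) + h := by linarith
    have h1x : 0 < 1 - x := by linarith
    rw [usage_mid_eq x T j' l₂ h hx0 hx1 hhj hlow hcomp2, usage_mid_eq x T j' l₁ h hx0 hx1 hhj hlow1 hcomp]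
    refine max_le_max ?_ ?_
    · -- heavy: (T−2l₂)/(l₂+h−T) ≤ (T−2l₁)/(l₁+h−T) ⟺ 0 ≤ (l₂−l₁)(2h−T)
      rw [div_le_div_iff₀ (by linarith) (by linarith)]
      nlinarith [mul_nonneg (sub_nonneg.2 hl'.le) (sub_nonneg.2 hmid)]
    · -- light: the numerator decreases and the denominator increases in `l`
      have hN1 : 0 < x ^ 2 * ((h : ℝ) - l₁) + (1 - x) * (T - 2 * (l₁ : ℝ)) := by
        have : (0 : ℝ) < (h : ℝ) - l₁ := by linarith
        positivity
      have hE1 : 0 < (1 - x) * ((1 - x) * (l₁ : ℝ) + (1 + x) * h - T) := by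
        apply mul_pos h1x; nlinarith
      refine div_le_div₀ hN1.le ?_ hE1 ?_
      · nlinarith [sq_nonneg x, mul_pos (mul_pos hx0 hx0) (sub_pos.2 hl')]
      · nlinarith [mul_pos (mul_pos h1x h1x) (sub_pos.2 hl')]

/-- **usage is antitone in the mid**: for a low `l` (`2l < T`) and mids `h₁ < h₂ ≤ j′` with `T < l + h₁`, `usage(l,h₂) ≤ usage(l,h₁)`
(`0 < x < 1`): higher mids are cheaper absorbers. [this work] -/
theorem usage_anti_mid (x T : ℝ) (j' l h₁ h₂ : ℕ) (hx0 : 0 < x) (hx1 : x < 1) (hh : h₁ < h₂) (hh2 : h₂ ≤ j')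
    (hlow : 2 * (l : ℝ) < T) (hcomp : T < (l : ℝ) + h₁) :
    usage x T j' l h₂ ≤ usage x T j' l h₁ := by
  have hh1 : h₁ ≤ j' := by omega
  have hh' : (h₁ : ℝ) < h₂ := by exact_mod_cast hh
  have hcomp2 : T < (l : ℝ) + h₂ := by linarith
  have h1x : 0 < 1 - x := by linarith
  rw [usage_mid_eq x T j' l h₂ hx0 hx1 hh2 hlow hcomp2, usage_mid_eq x T j' l h₁ hx0 hx1 hh1 hlow hcomp]
  refine max_le_max ?_ ?_
  · exact div_le_div_of_nonneg_left (by linarith) (by linarith) (by linarith)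
  · have hE1 : 0 < (1 - x) * ((1 - x) * (l : ℝ) + (1 + x) * h₁ - T) := by
      apply mul_pos h1x; nlinarith
    have hE2 : 0 < (1 - x) * ((1 - x) * (l : ℝ) + (1 + x) * h₂ - T) := by
      apply mul_pos h1x; nlinarith
    rw [div_le_div_iff₀ hE2 hE1]
    have key : (x ^ 2 * ((h₁ : ℝ) - l) + (1 - x) * (T - 2 * (l : ℝ))) * ((1 - x) * ((1 - x) * (l : ℝ) + (1 + x) * h₂ - T))
        - (x ^ 2 * ((h₂ : ℝ) - l) + (1 - x) * (T - 2 * (l : ℝ))) * ((1 - x) * ((1 - x) * (l : ℝ) + (1 + x) * h₁ - T))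
        = ((h₂ : ℝ) - h₁) * (1 - x) * (T - 2 * (l : ℝ)) := by ring
    have : 0 ≤ ((h₂ : ℝ) - h₁) * (1 - x) * (T - 2 * (l : ℝ)) :=
      mul_nonneg (mul_nonneg (by linarith) h1x.le) (by linarith)
    linarith

/-- **THE MONGE INEQUALITY FOR THE DEC USAGE RATES.**  Floor `0 < x < 1`, target `T`, layer `j′`; lows `l₁ < l₂` (`2l₂ < T`),
absorbers `h₁ < h₂` with `h₁` compatible with `l₁` (`T < l₁ + h₁`) and `h₁` a giant (`h₁ ≥ j′+1`) or a mid (`2h₁ ≥ T`).  Then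
`usage(l₂,h₁)·usage(l₁,h₂) ≤ usage(l₁,h₁)·usage(l₂,h₂)`: the "crossed" pairing (high low with low absorber, low low with high absorber —
the corner pattern) is jointly no more expensive than the "nested" one, so nested flows can be uncrossed (memo N45). [this work] -/
theorem usage_monge (x T : ℝ) (j' l₁ l₂ h₁ h₂ : ℕ) (hx0 : 0 < x) (hx1 : x < 1) (hl : l₁ < l₂) (hh : h₁ < h₂)
    (hlow : 2 * (l₂ : ℝ) < T) (hcomp : T < (l₁ : ℝ) + h₁) (habs : j' + 1 ≤ h₁ ∨ T ≤ 2 * (h₁ : ℝ)) :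
    usage x T j' l₂ h₁ * usage x T j' l₁ h₂ ≤ usage x T j' l₁ h₁ * usage x T j' l₂ h₂ := by
  have h1x : 0 < 1 - x := by linarith
  by_cases hg2 : j' + 1 ≤ h₂
  · by_cases hg1 : j' + 1 ≤ h₁
    · rw [usage_giant_eq x T j' l₂ h₁ hg1, usage_giant_eq x T j' l₁ h₂ hg2, usage_giant_eq x T j' l₁ h₁ hg1,
        usage_giant_eq x T j' l₂ h₂ hg2]
    · rw [usage_giant_eq x T j' l₁ h₂ hg2, usage_giant_eq x T j' l₂ h₂ hg2]
      exact mul_le_mul_of_nonneg_right (usage_anti_low x T j' l₁ l₂ h₁ hx0 hx1 hl hlow hcomp habs) (div_pos hx0 h1x).le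
  · -- both absorbers are mids
    have hh2 : h₂ ≤ j' := by omega
    have hh1 : h₁ ≤ j' := by omega
    have hl' : (l₁ : ℝ) < l₂ := by exact_mod_cast hl
    have hh' : (h₁ : ℝ) < h₂ := by exact_mod_cast hh
    have hlow1 : 2 * (l₁ : ℝ) < T := by linarith
    have hc12 : T < (l₁ : ℝ) + h₂ := by linarith
    have hc21 : T < (l₂ : ℝ) + h₁ := by linarith
    have hc22 : T < (l₂ : ℝ) + h₂ := by linarith
    rw [usage_mid_eq x T j' l₂ h₁ hx0 hx1 hh1 hlow hc21, usage_mid_eq x T j' l₁ h₂ hx0 hx1 hh2 hlow1 hc12,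
      usage_mid_eq x T j' l₁ h₁ hx0 hx1 hh1 hlow1 hcomp, usage_mid_eq x T j' l₂ h₂ hx0 hx1 hh2 hlow hc22]
    -- the four closed-form inequalities
    have hHH := heavy_monge T (l₁ : ℝ) l₂ h₁ h₂ hl'.le hh'.le hlow hcomp
    have hLL := light_monge x T (l₁ : ℝ) l₂ h₁ h₂ hx0 hx1 hl'.le hh'.le hlow hcomp
    have hHL := heavy_light_monge x T (l₁ : ℝ) l₂ h₁ h₂ hx0 hx1 hl'.le hh'.le hlow hcomp
    have hLH := light_heavy_monge x T (l₁ : ℝ) l₂ h₁ h₂ hx0 hx1 hl'.le hh'.le hlow hcomp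
    -- nonnegativity of the closed forms
    have pH : ∀ l h : ℝ, 2 * l < T → T < l + h → 0 ≤ (T - 2 * l) / (l + h - T) :=
      fun l h h1 h2 => (div_pos (by linarith) (by linarith)).le
    have pL : ∀ l h : ℝ, 2 * l < T → T < l + h →
        0 ≤ (x ^ 2 * (h - l) + (1 - x) * (T - 2 * l)) / ((1 - x) * ((1 - x) * l + (1 + x) * h - T)) := by
      intro l h h1 h2
      have : 0 < h - l := by linarith
      refine (div_pos (by positivity) (mul_pos h1x ?_)).le
      nlinarith
    have a11 := pH l₁ h₁ hlow1 hcomp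
    have a22 := pH l₂ h₂ hlow hc22
    have b22 := pL l₂ h₂ hlow hc22
    set A11 := (T - 2 * (l₁ : ℝ)) / ((l₁ : ℝ) + h₁ - T)
    set A12 := (T - 2 * (l₁ : ℝ)) / ((l₁ : ℝ) + h₂ - T)
    set A21 := (T - 2 * (l₂ : ℝ)) / ((l₂ : ℝ) + h₁ - T)
    set A22 := (T - 2 * (l₂ : ℝ)) / ((l₂ : ℝ) + h₂ - T)
    set B11 := (x ^ 2 * ((h₁ : ℝ) - l₁) + (1 - x) * (T - 2 * (l₁ : ℝ))) /
      ((1 - x) * ((1 - x) * (l₁ : ℝ) + (1 + x) * h₁ - T))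
    set B12 := (x ^ 2 * ((h₂ : ℝ) - l₁) + (1 - x) * (T - 2 * (l₁ : ℝ))) /
      ((1 - x) * ((1 - x) * (l₁ : ℝ) + (1 + x) * h₂ - T))
    set B21 := (x ^ 2 * ((h₁ : ℝ) - l₂) + (1 - x) * (T - 2 * (l₂ : ℝ))) /
      ((1 - x) * ((1 - x) * (l₂ : ℝ) + (1 + x) * h₁ - T))
    set B22 := (x ^ 2 * ((h₂ : ℝ) - l₂) + (1 - x) * (T - 2 * (l₂ : ℝ))) /
      ((1 - x) * ((1 - x) * (l₂ : ℝ) + (1 + x) * h₂ - T))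
    have r11 : 0 ≤ max A11 B11 := le_max_of_le_left a11
    rcases le_total A21 B21 with h21 | h21 <;> rcases le_total A12 B12 with h12 | h12
    · rw [max_eq_right h21, max_eq_right h12]
      exact hLL.trans (mul_le_mul (le_max_right _ _) (le_max_right _ _) b22 r11)
    · rw [max_eq_right h21, max_eq_left h12]
      exact hLH.trans (mul_le_mul (le_max_left _ _) (le_max_right _ _) b22 r11)
    · rw [max_eq_left h21, max_eq_right h12]
      exact hHL.trans (mul_le_mul (le_max_left _ _) (le_max_right _ _) b22 r11)
    · rw [max_eq_left h21, max_eq_left h12]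
      exact hHH.trans (mul_le_mul (le_max_left _ _) (le_max_left _ _) a22 r11)

end LawDec

end Quant

end Summit.CriticalPhenomena.PercolationContinuityZ3.Theorems
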